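import Mathlib
import Literature.NumberTheory.LFunctions.Zhang2022.Section15ResidueParams
import Literature.NumberTheory.LFunctions.Zhang2022.TypedSection15B
import Literature.NumberTheory.LFunctions.Zhang2022.TypedSection16B
import HarnessLib

/-!
# Zhang (2022) §15 (15.16) / §16 (16.11): the residues `ℛ₁ⱼ`, `ℛ₂ⱼ` as typed (`limUnder`) in closed form

Topic `Literature/NumberTheory/LFunctions/Zhang2022` (Landau–Siegel audit tree; verdict-neutral).
Y. Zhang, *Discrete mean estimates and the Landau–Siegel zero*, arXiv:2211.02515v1 (2022)
[Zhang2022LandauSiegel] — **an unrefereed manuscript under adjudication** (cell siegel-zhang, D-0069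
width campaign). DISCHARGE file (theorems only; no new definitions, no new facts); no statement about
Theorems 1–2 of the manuscript or about Landau–Siegel zeros is made or implied.

The typed objects `Typed.Section15B.calR1 c′ χ j` (`ℛ₁ⱼ` = "the residue of the function (15.16)
`ζ(1+s+β₁)ζ(1+s+β₂)/(ζ(1+s)L(1+s,χ)) · P₄^{s+β₃}ω₁(s+β₃)/(s+β₃)` at `s = −βⱼ`", [Z22 p.85, (15.16),
tex L4221–L4225]) and `Typed.Section16A.calR2 c′ χ j` (`ℛ₂ⱼ`, the residue of (16.11)
`ζ(1+s+β₁)/(ζ(1+s)L(1+s,χ)) · P₄^{s+β₂}ω₁(s+β₂)/(s+β₂)` at `s = −βⱼ`, [Z22 p.92, (16.11), tex L4552–L4556])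
are DEFINED as `limUnder (𝓝[≠] (−βⱼ)) (s ↦ (s+βⱼ)·F(s))`. This file computes those limits (the poles
are simple: from `ζ(1+s+βₖ)` with residue `1` — Mathlib `riemannZeta_residue_one` — or from the factor
`1/(s+βⱼ)`), under the non-vanishing/regularity conditions at the point that the later quantitative
files verify for all large `D` under (A):
* `calR1_one_eq`:   `ℛ₁₁ = ζ(1+β₂−β₁)/(ζ(1−β₁)L(1−β₁,χ)) · P₄^{β₃−β₁}ω₁(β₃−β₁)/(β₃−β₁)`;
* `calR1_two_eq`:   `ℛ₁₂ = ζ(1+β₁−β₂)/(ζ(1−β₂)L(1−β₂,χ)) · P₄^{β₃−β₂}ω₁(β₃−β₂)/(β₃−β₂)`;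
* `calR1_three_eq`: `ℛ₁₃ = ζ(1+β₁−β₃)ζ(1+β₂−β₃)/(ζ(1−β₃)L(1−β₃,χ)) · P₄⁰ω₁(0)`;
* `calR2_one_eq`:   `ℛ₂₁ = (ζ(1−β₁)L(1−β₁,χ))⁻¹ · P₄^{β₂−β₁}ω₁(β₂−β₁)/(β₂−β₁)`;
* `calR2_two_eq`:   `ℛ₂₂ = ζ(1+β₁−β₂)/(ζ(1−β₂)L(1−β₂,χ)) · P₄⁰ω₁(0)`.
Also: `zeta1_near_one` (a quantitative form of `ζ(s) = (s−1)⁻¹ζ₁(s)`, `ζ₁(1) = 1`, `ζ₁` entire — Mathlib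
`riemannZeta₁`): on a fixed punctured disc around `1`, `ζ(s) ≠ 0` and `|(s−1)ζ(s) − 1| ≤ K|s−1| ≤ 1/2`.
-/

noncomputable section

open Complex Real Filter Topology Asymptotics

namespace Literature.NumberTheory.LFunctions.Zhang2022.ResidueValues

open Skeleton

/-! ## `ζ` near `s = 1` -/

/-- **`ζ` near its pole, quantitatively**: there are `r > 0` and `K ≥ 0` with
`|ζ₁(s) − 1| ≤ K|s − 1|` and `|ζ₁(s) − 1| ≤ 1/2` for `|s − 1| < r`, where `ζ(s) = (s−1)⁻¹ζ₁(s)`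
(Mathlib `riemannZeta₁`, entire, `ζ₁(1) = 1`). [cite: Zhang2022LandauSiegel, §15 (15.16) p. 85] -/
theorem zeta1_near_one : ∃ r : ℝ, 0 < r ∧ ∃ K : ℝ, 0 ≤ K ∧ ∀ s : ℂ, ‖s - 1‖ < r →
    ‖riemannZeta₁ s - 1‖ ≤ K * ‖s - 1‖ ∧ ‖riemannZeta₁ s - 1‖ ≤ 1 / 2 := by
  have hd : DifferentiableAt ℂ riemannZeta₁ 1 := differentiable_riemannZeta₁.differentiableAt
  have hO := hd.isBigO_sub
  rw [riemannZeta₁_one] at hO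
  obtain ⟨c, hc⟩ := hO.bound
  have hcont : ContinuousAt riemannZeta₁ 1 := hd.continuousAt
  have hev : ∀ᶠ s in 𝓝 (1 : ℂ), ‖riemannZeta₁ s - 1‖ < 1 / 2 := by
    have h : Tendsto riemannZeta₁ (𝓝 1) (𝓝 1) := by
      have h' := hcont.tendsto; rwa [riemannZeta₁_one] at h'
    have h2 := Metric.tendsto_nhds.mp h (1 / 2) (by norm_num)
    filter_upwards [h2] with s hs
    rwa [dist_eq_norm] at hs
  obtain ⟨r, hr, h⟩ := Metric.eventually_nhds_iff.mp (hc.and hev)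
  refine ⟨r, hr, max c 0, le_max_right _ _, fun s hs => ?_⟩
  obtain ⟨h1, h2⟩ := h (by rwa [dist_eq_norm])
  refine ⟨h1.trans ?_, le_of_lt h2⟩
  gcongr
  exact le_max_left _ _

/-- Consequences on the punctured disc: `ζ(s) ≠ 0`, `(s−1)ζ(s) = ζ₁(s)`, `|(s−1)ζ(s) − 1| ≤ K|s−1|`
and `|(s−1)ζ(s) − 1| ≤ 1/2`. [cite: Zhang2022LandauSiegel, §15 (15.16) p. 85] -/
theorem zeta_near_one : ∃ r : ℝ, 0 < r ∧ ∃ K : ℝ, 0 ≤ K ∧ ∀ s : ℂ, s ≠ 1 → ‖s - 1‖ < r →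
    riemannZeta s ≠ 0 ∧ ‖(s - 1) * riemannZeta s - 1‖ ≤ K * ‖s - 1‖ ∧
      ‖(s - 1) * riemannZeta s - 1‖ ≤ 1 / 2 := by
  obtain ⟨r, hr, K, hK, h⟩ := zeta1_near_one
  refine ⟨r, hr, K, hK, fun s hs1 hsr => ?_⟩
  obtain ⟨h1, h2⟩ := h s hsr
  have hne : s - 1 ≠ 0 := sub_ne_zero.mpr hs1
  have hmul : (s - 1) * riemannZeta s = riemannZeta₁ s := by
    rw [riemannZeta_eq_inv_sub_mul hs1, ← mul_assoc, mul_inv_cancel₀ hne, one_mul]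
  rw [hmul]
  refine ⟨?_, h1, h2⟩
  intro h0
  have : riemannZeta₁ s = 0 := by rw [← hmul, h0, mul_zero]
  rw [this, zero_sub, norm_neg, norm_one] at h2
  norm_num at h2

/-! ## The simple pole of `ζ(1+s+b)` at `s = −b` -/

/-- `s ↦ 1 + s + b` maps the punctured neighbourhood of `−b` into that of `1`.
[cite: Zhang2022LandauSiegel, §15 (15.16) p. 85] -/
theorem tendsto_one_add_add_nhdsNE (b : ℂ) :
    Tendsto (fun s : ℂ => 1 + s + b) (𝓝[≠] (-b)) (𝓝[≠] 1) := by
  refine tendsto_nhdsWithin_of_tendsto_nhds_of_eventually_within _ ?_ ?_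
  · have hc : Continuous fun s : ℂ => 1 + s + b := by fun_prop
    have h := hc.tendsto (-b)
    rw [show (1 : ℂ) + -b + b = 1 by ring] at h
    exact h.mono_left nhdsWithin_le_nhds
  · filter_upwards [self_mem_nhdsWithin] with s hs
    simp only [Set.mem_compl_iff, Set.mem_singleton_iff] at hs ⊢
    intro h; exact hs (by linear_combination h)

/-- **Residue `1` of `ζ(1+s+b)` at `s = −b`**: `(s+b)ζ(1+s+b) → 1` as `s → −b`, `s ≠ −b`
(Mathlib `riemannZeta_residue_one`). [cite: Zhang2022LandauSiegel, §15 (15.16) p. 85] -/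
theorem tendsto_add_mul_zeta (b : ℂ) :
    Tendsto (fun s : ℂ => (s + b) * riemannZeta (1 + s + b)) (𝓝[≠] (-b)) (𝓝 1) := by
  have h := riemannZeta_residue_one.comp (tendsto_one_add_add_nhdsNE b)
  refine h.congr fun s => ?_
  simp only [Function.comp_apply]
  ring

/-! ## Continuity of the regular factors -/

section Regular

variable {D : ℕ} [NeZero D] (χ : DirichletCharacter ℂ D)

/-- `s ↦ ζ(1+s+a)` is continuous at `z` when `1+z+a ≠ 1`. [cite: Zhang2022LandauSiegel, §15 (15.16) p. 85] -/
theorem continuousAt_zeta_shift (a z : ℂ) (h : z + a ≠ 0) :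
    ContinuousAt (fun s : ℂ => riemannZeta (1 + s + a)) z := by
  have h1 : (1 : ℂ) + z + a ≠ 1 := by
    intro h'; apply h; linear_combination h'
  exact (differentiableAt_riemannZeta h1).continuousAt.comp (f := fun s : ℂ => 1 + s + a)
    (by fun_prop)

/-- `s ↦ ζ(1+s)` is continuous at `z ≠ 0`. [cite: Zhang2022LandauSiegel, §15 (15.16) p. 85] -/
theorem continuousAt_zeta_one_add (z : ℂ) (h : z ≠ 0) :
    ContinuousAt (fun s : ℂ => riemannZeta (1 + s)) z := by
  have h1 : (1 : ℂ) + z ≠ 1 := by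
    intro h'; apply h; linear_combination h'
  exact (differentiableAt_riemannZeta h1).continuousAt.comp (f := fun s : ℂ => 1 + s) (by fun_prop)

/-- `s ↦ L(1+s,χ)` is continuous (`χ ≠ 1`). [cite: Zhang2022LandauSiegel, §15 (15.16) p. 85] -/
theorem continuousAt_LFunction_one_add (hχ : χ ≠ 1) (z : ℂ) :
    ContinuousAt (fun s : ℂ => χ.LFunction (1 + s)) z :=
  ((DirichletCharacter.differentiable_LFunction hχ).continuous.comp
    (by fun_prop : Continuous fun s : ℂ => 1 + s)).continuousAt

omit [NeZero D] in
/-- `s ↦ P₄^{s+a}ω₁(s+a)` is continuous (`P₄ > 0`). [cite: Zhang2022LandauSiegel, §15 (15.16) p. 85] -/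
theorem continuousAt_P4pow_omega1 (hP : 0 < P4 D) (a z : ℂ) :
    ContinuousAt (fun s : ℂ => ((P4 D : ℝ) : ℂ) ^ (s + a) * GaussWeight.omega1 (ell D ^ 30) (s + a)) z := by
  have hP' : ((P4 D : ℝ) : ℂ) ≠ 0 := Complex.ofReal_ne_zero.mpr hP.ne'
  refine ContinuousAt.mul ?_ ?_
  · exact ContinuousAt.const_cpow (by fun_prop) (Or.inl hP')
  · unfold GaussWeight.omega1
    fun_prop

end Regular

/-! ## The residues `ℛ₁ⱼ` of (15.16) in closed form -/

section ResiduesFifteen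

open Typed.Section15B

variable (c' : ℝ) {D : ℕ} [NeZero D] (χ : DirichletCharacter ℂ D)

/-- **`ℛ₁₁` in closed form** (the pole of `ζ(1+s+β₁)` at `s = −β₁` is simple with residue `1`):
`ℛ₁₁ = ζ(1+β₂−β₁)/(ζ(1−β₁)L(1−β₁,χ)) · P₄^{β₃−β₁}ω₁(β₃−β₁)/(β₃−β₁)`, provided the displayed
denominators do not vanish (`β₁ ≠ β₂`, `β₁ ≠ β₃`, `β₁ ≠ 0`, `ζ(1−β₁) ≠ 0`, `L(1−β₁,χ) ≠ 0`, `χ ≠ 1`,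
`P₄ > 0`). [cite: Zhang2022LandauSiegel, §15 (15.16) p. 85] -/
theorem calR1_one_eq (hχ : χ ≠ 1) (hP : 0 < P4 D) (h12 : beta2 c' D - beta1 c' D ≠ 0)
    (h13 : beta3 c' D - beta1 c' D ≠ 0) (h1 : beta1 c' D ≠ 0)
    (hζ : riemannZeta (1 - beta1 c' D) ≠ 0) (hL : χ.LFunction (1 - beta1 c' D) ≠ 0) :
    calR1 c' χ 1 =
      riemannZeta (1 + beta2 c' D - beta1 c' D) /
          (riemannZeta (1 - beta1 c' D) * χ.LFunction (1 - beta1 c' D)) *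
        (((P4 D : ℝ) : ℂ) ^ (beta3 c' D - beta1 c' D) *
          GaussWeight.omega1 (ell D ^ 30) (beta3 c' D - beta1 c' D) / (beta3 c' D - beta1 c' D)) := by
  unfold calR1
  rw [betaJ_one]
  -- the regular factor
  set g : ℂ → ℂ := fun s => riemannZeta (1 + s + beta2 c' D) / (riemannZeta (1 + s) * χ.LFunction (1 + s)) *
    (((P4 D : ℝ) : ℂ) ^ (s + beta3 c' D) * GaussWeight.omega1 (ell D ^ 30) (s + beta3 c' D) / (s + beta3 c' D)) with hg
  have hg_cont : ContinuousAt g (-beta1 c' D) := by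
    have e2 : -beta1 c' D + beta2 c' D ≠ 0 := by rw [neg_add_eq_sub]; exact h12
    have e3 : -beta1 c' D + beta3 c' D ≠ 0 := by rw [neg_add_eq_sub]; exact h13
    have cζ2 := continuousAt_zeta_shift (beta2 c' D) (-beta1 c' D) e2
    have cζ := continuousAt_zeta_one_add (-beta1 c' D) (neg_ne_zero.mpr h1)
    have cL := continuousAt_LFunction_one_add χ hχ (-beta1 c' D)
    have cPω := continuousAt_P4pow_omega1 (D := D) hP (beta3 c' D) (-beta1 c' D)
    have clin : ContinuousAt (fun s : ℂ => s + beta3 c' D) (-beta1 c' D) := by fun_prop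
    have hζ' : riemannZeta (1 + -beta1 c' D) ≠ 0 := by rw [← sub_eq_add_neg]; exact hζ
    have hL' : χ.LFunction (1 + -beta1 c' D) ≠ 0 := by rw [← sub_eq_add_neg]; exact hL
    refine ContinuousAt.mul (ContinuousAt.div cζ2 (cζ.mul cL) (mul_ne_zero hζ' hL')) ?_
    exact ContinuousAt.div cPω clin e3
  have hkey : ∀ s : ℂ, (s + beta1 c' D) * F1516 c' χ s = ((s + beta1 c' D) * riemannZeta (1 + s + beta1 c' D)) * g s := by
    intro s; rw [hg]; unfold F1516; ring
  have hlim : Tendsto (fun s => (s + beta1 c' D) * F1516 c' χ s) (𝓝[≠] (-beta1 c' D)) (𝓝 (1 * g (-beta1 c' D))) := by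
    refine Tendsto.congr (fun s => (hkey s).symm) ?_
    exact (tendsto_add_mul_zeta (beta1 c' D)).mul (hg_cont.tendsto.mono_left nhdsWithin_le_nhds)
  rw [hlim.limUnder_eq, one_mul, hg]
  simp only [neg_add_eq_sub, ← sub_eq_add_neg]
  ring_nf

/-- **`ℛ₁₂` in closed form** (pole of `ζ(1+s+β₂)` at `s = −β₂`):
`ℛ₁₂ = ζ(1+β₁−β₂)/(ζ(1−β₂)L(1−β₂,χ)) · P₄^{β₃−β₂}ω₁(β₃−β₂)/(β₃−β₂)`.
[cite: Zhang2022LandauSiegel, §15 (15.16) p. 85] -/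
theorem calR1_two_eq (hχ : χ ≠ 1) (hP : 0 < P4 D) (h21 : beta1 c' D - beta2 c' D ≠ 0)
    (h23 : beta3 c' D - beta2 c' D ≠ 0) (h2 : beta2 c' D ≠ 0)
    (hζ : riemannZeta (1 - beta2 c' D) ≠ 0) (hL : χ.LFunction (1 - beta2 c' D) ≠ 0) :
    calR1 c' χ 2 =
      riemannZeta (1 + beta1 c' D - beta2 c' D) /
          (riemannZeta (1 - beta2 c' D) * χ.LFunction (1 - beta2 c' D)) *
        (((P4 D : ℝ) : ℂ) ^ (beta3 c' D - beta2 c' D) *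
          GaussWeight.omega1 (ell D ^ 30) (beta3 c' D - beta2 c' D) / (beta3 c' D - beta2 c' D)) := by
  unfold calR1
  rw [betaJ_two]
  set g : ℂ → ℂ := fun s => riemannZeta (1 + s + beta1 c' D) / (riemannZeta (1 + s) * χ.LFunction (1 + s)) *
    (((P4 D : ℝ) : ℂ) ^ (s + beta3 c' D) * GaussWeight.omega1 (ell D ^ 30) (s + beta3 c' D) / (s + beta3 c' D)) with hg
  have hg_cont : ContinuousAt g (-beta2 c' D) := by
    have e1 : -beta2 c' D + beta1 c' D ≠ 0 := by rw [neg_add_eq_sub]; exact h21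
    have e3 : -beta2 c' D + beta3 c' D ≠ 0 := by rw [neg_add_eq_sub]; exact h23
    have cζ1 := continuousAt_zeta_shift (beta1 c' D) (-beta2 c' D) e1
    have cζ := continuousAt_zeta_one_add (-beta2 c' D) (neg_ne_zero.mpr h2)
    have cL := continuousAt_LFunction_one_add χ hχ (-beta2 c' D)
    have cPω := continuousAt_P4pow_omega1 (D := D) hP (beta3 c' D) (-beta2 c' D)
    have clin : ContinuousAt (fun s : ℂ => s + beta3 c' D) (-beta2 c' D) := by fun_prop
    have hζ' : riemannZeta (1 + -beta2 c' D) ≠ 0 := by rw [← sub_eq_add_neg]; exact hζ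
    have hL' : χ.LFunction (1 + -beta2 c' D) ≠ 0 := by rw [← sub_eq_add_neg]; exact hL
    refine ContinuousAt.mul (ContinuousAt.div cζ1 (cζ.mul cL) (mul_ne_zero hζ' hL')) ?_
    exact ContinuousAt.div cPω clin e3
  have hkey : ∀ s : ℂ, (s + beta2 c' D) * F1516 c' χ s = ((s + beta2 c' D) * riemannZeta (1 + s + beta2 c' D)) * g s := by
    intro s; rw [hg]; unfold F1516; ring
  have hlim : Tendsto (fun s => (s + beta2 c' D) * F1516 c' χ s) (𝓝[≠] (-beta2 c' D)) (𝓝 (1 * g (-beta2 c' D))) := by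
    refine Tendsto.congr (fun s => (hkey s).symm) ?_
    exact (tendsto_add_mul_zeta (beta2 c' D)).mul (hg_cont.tendsto.mono_left nhdsWithin_le_nhds)
  rw [hlim.limUnder_eq, one_mul, hg]
  simp only [neg_add_eq_sub, ← sub_eq_add_neg]
  ring_nf

/-- **`ℛ₁₃` in closed form** (the pole at `s = −β₃` comes from the factor `1/(s+β₃)`; `P₄⁰ω₁(0)` kept
unevaluated): `ℛ₁₃ = ζ(1+β₁−β₃)ζ(1+β₂−β₃)/(ζ(1−β₃)L(1−β₃,χ)) · P₄^{β₃−β₃}ω₁(β₃−β₃)`.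
[cite: Zhang2022LandauSiegel, §15 (15.16) p. 85] -/
theorem calR1_three_eq (hχ : χ ≠ 1) (hP : 0 < P4 D) (h31 : beta1 c' D - beta3 c' D ≠ 0)
    (h32 : beta2 c' D - beta3 c' D ≠ 0) (h3 : beta3 c' D ≠ 0)
    (hζ : riemannZeta (1 - beta3 c' D) ≠ 0) (hL : χ.LFunction (1 - beta3 c' D) ≠ 0) :
    calR1 c' χ 3 =
      riemannZeta (1 + beta1 c' D - beta3 c' D) * riemannZeta (1 + beta2 c' D - beta3 c' D) /
          (riemannZeta (1 - beta3 c' D) * χ.LFunction (1 - beta3 c' D)) *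
        (((P4 D : ℝ) : ℂ) ^ (beta3 c' D - beta3 c' D) *
          GaussWeight.omega1 (ell D ^ 30) (beta3 c' D - beta3 c' D)) := by
  unfold calR1
  rw [betaJ_three]
  set g : ℂ → ℂ := fun s => riemannZeta (1 + s + beta1 c' D) * riemannZeta (1 + s + beta2 c' D) /
      (riemannZeta (1 + s) * χ.LFunction (1 + s)) *
    (((P4 D : ℝ) : ℂ) ^ (s + beta3 c' D) * GaussWeight.omega1 (ell D ^ 30) (s + beta3 c' D)) with hg
  have hg_cont : ContinuousAt g (-beta3 c' D) := by
    have e1 : -beta3 c' D + beta1 c' D ≠ 0 := by rw [neg_add_eq_sub]; exact h31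
    have e2 : -beta3 c' D + beta2 c' D ≠ 0 := by rw [neg_add_eq_sub]; exact h32
    have cζ1 := continuousAt_zeta_shift (beta1 c' D) (-beta3 c' D) e1
    have cζ2 := continuousAt_zeta_shift (beta2 c' D) (-beta3 c' D) e2
    have cζ := continuousAt_zeta_one_add (-beta3 c' D) (neg_ne_zero.mpr h3)
    have cL := continuousAt_LFunction_one_add χ hχ (-beta3 c' D)
    have cPω := continuousAt_P4pow_omega1 (D := D) hP (beta3 c' D) (-beta3 c' D)
    have hζ' : riemannZeta (1 + -beta3 c' D) ≠ 0 := by rw [← sub_eq_add_neg]; exact hζ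
    have hL' : χ.LFunction (1 + -beta3 c' D) ≠ 0 := by rw [← sub_eq_add_neg]; exact hL
    exact ContinuousAt.mul (ContinuousAt.div (cζ1.mul cζ2) (cζ.mul cL) (mul_ne_zero hζ' hL')) cPω
  -- on the punctured neighbourhood `(s + β₃)·F(s) = g(s)`
  have hkey : ∀ s : ℂ, s ≠ -beta3 c' D → (s + beta3 c' D) * F1516 c' χ s = g s := by
    intro s hs
    have hne : s + beta3 c' D ≠ 0 := by
      intro h; apply hs; linear_combination h
    rw [hg]; unfold F1516
    field_simp
  have hlim : Tendsto (fun s => (s + beta3 c' D) * F1516 c' χ s) (𝓝[≠] (-beta3 c' D)) (𝓝 (g (-beta3 c' D))) := by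
    refine Tendsto.congr' ?_ (hg_cont.tendsto.mono_left nhdsWithin_le_nhds)
    filter_upwards [self_mem_nhdsWithin] with s hs
    exact (hkey s hs).symm
  rw [hlim.limUnder_eq, hg]
  simp only [neg_add_eq_sub, ← sub_eq_add_neg]
  ring_nf

end ResiduesFifteen

/-! ## The residues `ℛ₂ⱼ` of (16.11) in closed form -/

section ResiduesSixteen

open Typed.Section16A

variable (c' : ℝ) {D : ℕ} [NeZero D] (χ : DirichletCharacter ℂ D)

/-- **`ℛ₂₁` in closed form** (pole of `ζ(1+s+β₁)` at `s = −β₁`):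
`ℛ₂₁ = (ζ(1−β₁)L(1−β₁,χ))⁻¹ · P₄^{β₂−β₁}ω₁(β₂−β₁)/(β₂−β₁)`.
[cite: Zhang2022LandauSiegel, §16 (16.11) p. 92] -/
theorem calR2_one_eq (hχ : χ ≠ 1) (hP : 0 < P4 D) (h12 : beta2 c' D - beta1 c' D ≠ 0)
    (h1 : beta1 c' D ≠ 0)
    (hζ : riemannZeta (1 - beta1 c' D) ≠ 0) (hL : χ.LFunction (1 - beta1 c' D) ≠ 0) :
    calR2 c' χ 1 =
      (riemannZeta (1 - beta1 c' D) * χ.LFunction (1 - beta1 c' D))⁻¹ *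
        (((P4 D : ℝ) : ℂ) ^ (beta2 c' D - beta1 c' D) *
          GaussWeight.omega1 (ell D ^ 30) (beta2 c' D - beta1 c' D) / (beta2 c' D - beta1 c' D)) := by
  unfold calR2
  rw [betaJ_one]
  set g : ℂ → ℂ := fun s => (riemannZeta (1 + s) * χ.LFunction (1 + s))⁻¹ *
    (((P4 D : ℝ) : ℂ) ^ (s + beta2 c' D) * GaussWeight.omega1 (ell D ^ 30) (s + beta2 c' D) / (s + beta2 c' D)) with hg
  have hg_cont : ContinuousAt g (-beta1 c' D) := by
    have e2 : -beta1 c' D + beta2 c' D ≠ 0 := by rw [neg_add_eq_sub]; exact h12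
    have cζ := continuousAt_zeta_one_add (-beta1 c' D) (neg_ne_zero.mpr h1)
    have cL := continuousAt_LFunction_one_add χ hχ (-beta1 c' D)
    have cPω := continuousAt_P4pow_omega1 (D := D) hP (beta2 c' D) (-beta1 c' D)
    have clin : ContinuousAt (fun s : ℂ => s + beta2 c' D) (-beta1 c' D) := by fun_prop
    have hζ' : riemannZeta (1 + -beta1 c' D) ≠ 0 := by rw [← sub_eq_add_neg]; exact hζ
    have hL' : χ.LFunction (1 + -beta1 c' D) ≠ 0 := by rw [← sub_eq_add_neg]; exact hL
    refine ContinuousAt.mul ((cζ.mul cL).inv₀ (mul_ne_zero hζ' hL')) ?_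
    exact ContinuousAt.div cPω clin e2
  have hkey : ∀ s : ℂ, (s + beta1 c' D) * F1611 c' χ s = ((s + beta1 c' D) * riemannZeta (1 + s + beta1 c' D)) * g s := by
    intro s; rw [hg]; unfold F1611; ring
  have hlim : Tendsto (fun s => (s + beta1 c' D) * F1611 c' χ s) (𝓝[≠] (-beta1 c' D)) (𝓝 (1 * g (-beta1 c' D))) := by
    refine Tendsto.congr (fun s => (hkey s).symm) ?_
    exact (tendsto_add_mul_zeta (beta1 c' D)).mul (hg_cont.tendsto.mono_left nhdsWithin_le_nhds)
  rw [hlim.limUnder_eq, one_mul, hg]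
  simp only [neg_add_eq_sub, ← sub_eq_add_neg]

/-- **`ℛ₂₂` in closed form** (the pole at `s = −β₂` comes from `1/(s+β₂)`; `P₄⁰ω₁(0)` kept
unevaluated): `ℛ₂₂ = ζ(1+β₁−β₂)/(ζ(1−β₂)L(1−β₂,χ)) · P₄^{β₂−β₂}ω₁(β₂−β₂)`.
[cite: Zhang2022LandauSiegel, §16 (16.11) p. 92] -/
theorem calR2_two_eq (hχ : χ ≠ 1) (hP : 0 < P4 D) (h21 : beta1 c' D - beta2 c' D ≠ 0)
    (h2 : beta2 c' D ≠ 0)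
    (hζ : riemannZeta (1 - beta2 c' D) ≠ 0) (hL : χ.LFunction (1 - beta2 c' D) ≠ 0) :
    calR2 c' χ 2 =
      riemannZeta (1 + beta1 c' D - beta2 c' D) /
          (riemannZeta (1 - beta2 c' D) * χ.LFunction (1 - beta2 c' D)) *
        (((P4 D : ℝ) : ℂ) ^ (beta2 c' D - beta2 c' D) *
          GaussWeight.omega1 (ell D ^ 30) (beta2 c' D - beta2 c' D)) := by
  unfold calR2
  rw [betaJ_two]
  set g : ℂ → ℂ := fun s => riemannZeta (1 + s + beta1 c' D) / (riemannZeta (1 + s) * χ.LFunction (1 + s)) *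
    (((P4 D : ℝ) : ℂ) ^ (s + beta2 c' D) * GaussWeight.omega1 (ell D ^ 30) (s + beta2 c' D)) with hg
  have hg_cont : ContinuousAt g (-beta2 c' D) := by
    have e1 : -beta2 c' D + beta1 c' D ≠ 0 := by rw [neg_add_eq_sub]; exact h21
    have cζ1 := continuousAt_zeta_shift (beta1 c' D) (-beta2 c' D) e1
    have cζ := continuousAt_zeta_one_add (-beta2 c' D) (neg_ne_zero.mpr h2)
    have cL := continuousAt_LFunction_one_add χ hχ (-beta2 c' D)
    have cPω := continuousAt_P4pow_omega1 (D := D) hP (beta2 c' D) (-beta2 c' D)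
    have hζ' : riemannZeta (1 + -beta2 c' D) ≠ 0 := by rw [← sub_eq_add_neg]; exact hζ
    have hL' : χ.LFunction (1 + -beta2 c' D) ≠ 0 := by rw [← sub_eq_add_neg]; exact hL
    exact ContinuousAt.mul (ContinuousAt.div cζ1 (cζ.mul cL) (mul_ne_zero hζ' hL')) cPω
  have hkey : ∀ s : ℂ, s ≠ -beta2 c' D → (s + beta2 c' D) * F1611 c' χ s = g s := by
    intro s hs
    have hne : s + beta2 c' D ≠ 0 := by
      intro h; apply hs; linear_combination h
    rw [hg]; unfold F1611
    field_simp
  have hlim : Tendsto (fun s => (s + beta2 c' D) * F1611 c' χ s) (𝓝[≠] (-beta2 c' D)) (𝓝 (g (-beta2 c' D))) := by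
    refine Tendsto.congr' ?_ (hg_cont.tendsto.mono_left nhdsWithin_le_nhds)
    filter_upwards [self_mem_nhdsWithin] with s hs
    exact (hkey s hs).symm
  rw [hlim.limUnder_eq, hg]
  simp only [neg_add_eq_sub, ← sub_eq_add_neg]
  ring_nf

end ResiduesSixteen

end Literature.NumberTheory.LFunctions.Zhang2022.ResidueValues
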